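import Literature.AnabelianGeometry.EtaleTheta.EtaleThetaClass
import Literature.AnabelianGeometry.EtaleTheta.SettingGaloisFacts
import HarnessLib

/-!
# [EtTh] §1 p.13–14: the origin clause «`Π^tp_{Z_N}` IS the subgroup cut out by the canonical splitting over `G_{J_N}`»
# (additive predicate in the origin-clause family; root owner)

Mochizuki, *The étale theta function and its Frobenioid-theoretic manifestations*, Publ. RIMS **45** (2009), §1, kurims
p. 13 l. 11–46 (PRIMS p. 14): «J_N := K_N(a^{1/N})_{a ∈ K_N} … we have an exact sequence
1 → Δ_Θ ⊗ ℤ/Nℤ (≅ ℤ/Nℤ(1)) → (Π^tp_{Y_N})^Θ/N·(Δ^tp_Y)^Θ → G_{K_N} → 1 [cf. the construction of Y_N]. Since any two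
splittings of this exact sequence differ by a cohomology class ∈ H¹(G_{K_N}, ℤ/Nℤ(1)), it follows [by the definition of
J_N] that all splittings of this exact sequence determine the same splitting over G_{J_N}. Thus, the image of the resulting
open immersion G_{J_N} ↪ (Π^tp_{Y_N})^Θ/N·(Δ^tp_Y)^Θ is stabilized by the conjugation action of Π^tp_X, hence determines a
Galois covering Z_N → Y_N such that the resulting surjection Π^tp_{Y_N} ↠ Gal(Z_N/Y_N), whose kernel we denote by
Π^tp_{Z_N}, induces a natural exact sequence 1 → Δ_Θ ⊗ ℤ/Nℤ → Gal(Z_N/Y_N) → Gal(J_N/K_N) → 1»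
[cite: MochizukiEtTh2009, §1 p.14]. abc-iut cell, layer L2, seat abc-iut-L2-t1 (§1 ROOT owner). CLASS (c): ONE additive
`Prop`-valued predicate on the FROZEN root `ThetaSetting` v3 (whose axioms for `GtpZN` record only
`GtpZN_le`/`map_aug_GtpZN`/normality/openness/`relIndex_deltaZN`/`ker_toTheta_le_GtpZN`, not HOW print DEFINES `Z_N`),
in the origin-clause family of abc-iut-L2-t6's `IsThm16Origin` (whose clause R2 `Thm16Sub.GtpYNFromCusp` is the twin
for `Y_N`); never asserted. WHY: the covering clause «γ carries Π^tp_{Z_N,α} onto Π^tp_{Z_N,β}» (hypothesis `hZN` of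
`IsInversionAut.transport`, Prop. 1.8 / Thm 1.6 (i)-type) needs a group-theoretic characterisation of `Z_N`; for `Y_N`
it is abc-iut-L6-d5's `Thm16Sub.map_GtpYN_eq_of_inputs` from R2.

* `ThetaSetting.thetaPowersY D N` — `N·(Δ^tp_Y)^Θ`, the subgroup of `(Π^tp_X)^Θ` generated by the `N`-th powers of
  `(Δ^tp_Y)^Θ` («(Δ^tp_Y)^Θ … abelian», p. 12);
* `ThetaSetting.IsThetaSplittingAt D N s` — `s : G_{K_N} → (Π^tp_X)^Θ` is (a lift of) a splitting of
  `(Π^tp_{Y_N})^Θ/N·(Δ^tp_Y)^Θ ↠ G_{K_N}`: a homomorphism modulo `N·(Δ^tp_Y)^Θ`, valued in `(Π^tp_{Y_N})^Θ`, lying over the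
  identity of `G_{K_N}`;
* `ThetaSetting.GtpZNFromSplitting D N` — THE CLAUSE: for every such `s`, `Π^tp_{Z_N}` = the elements `g ∈ Π^tp_{Y_N}`
  with `aug g ∈ G_{J_N}` whose image in `(Π^tp_X)^Θ` agrees with `s(aug g)` modulo `N·(Δ^tp_Y)^Θ`.
HONEST FRAMING: a property of the GENUINE data that the typed interface omits; nothing asserted; [EtTh] is refereed;
nothing here bears on [IUTchIII] Cor. 3.12; typed ≠ proved.
-/

noncomputable section

namespace Literature.AnabelianGeometry.EtaleTheta

open Literature.AnabelianGeometry.SemiGraphs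

namespace ThetaSetting

variable {p : ℕ} [Fact p.Prime]

/-- **`N·(Δ^tp_Y)^Θ`**: the subgroup of `(Π^tp_X)^Θ` generated by the `N`-th powers of `(Δ^tp_Y)^Θ` (p. 13 «(Π^tp_{Y_N})^Θ /
N·(Δ^tp_Y)^Θ»; `(Δ^tp_Y)^Θ` is abelian, p. 12). [cite: MochizukiEtTh2009, §1 p.14] -/
def thetaPowersY (D : ThetaSetting p) (N : ℕ+) : Subgroup D.GtpTheta :=
  Subgroup.closure ((fun y : D.GtpTheta => y ^ (N : ℕ)) '' (D.DtpYTheta : Set D.GtpTheta))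

/-- **A (lifted) splitting over `G_{K_N}` of `(Π^tp_{Y_N})^Θ/N·(Δ^tp_Y)^Θ ↠ G_{K_N}`** (p. 13 «any two splittings of this
exact sequence …»): a map `s : G_{K_N} → (Π^tp_X)^Θ`, multiplicative modulo `N·(Δ^tp_Y)^Θ`, whose value at `σ` is the
image of an element of `Π^tp_{Y_N}` lying over `σ`. (No augmentation on `(Π^tp_X)^Θ` is part of the root interface; «lies
over σ» is phrased through `Π^tp_{Y_N}`, the kernel of `(·)^Θ` lying in `Δ^tp_X`.) [cite: MochizukiEtTh2009, §1 p.14] -/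
structure IsThetaSplittingAt (D : ThetaSetting p) (N : ℕ+) (s : ↥(D.GKN N) → D.GtpTheta) : Prop where
  /-- `s(σ)` is the image of some `g ∈ Π^tp_{Y_N}` with `aug g = σ`. -/
  exists_lift : ∀ σ : ↥(D.GKN N), ∃ g ∈ D.GtpYN N, D.aug g = (σ : GQp p) ∧ D.toTheta g = s σ
  /-- `s` is a homomorphism modulo `N·(Δ^tp_Y)^Θ`. -/
  map_mul_mem : ∀ σ τ : ↥(D.GKN N), s (σ * τ) * (s σ * s τ)⁻¹ ∈ D.thetaPowersY N

/-- **The origin clause for `Z_N`** (print's CONSTRUCTION of `Z_N`, kurims p. 13 l. 25–46): for EVERY lifted splitting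
`s` over `G_{K_N}`, the subgroup `Π^tp_{Z_N}` of the root datum IS the set of `g ∈ Π^tp_{Y_N}` with `aug g ∈ G_{J_N}` whose
image in `(Π^tp_X)^Θ` agrees with `s(aug g)` modulo `N·(Δ^tp_Y)^Θ` — «all splittings … determine the same splitting over
G_{J_N} … the image of the resulting open immersion G_{J_N} ↪ (Π^tp_{Y_N})^Θ/N·(Δ^tp_Y)^Θ … determines a Galois covering
Z_N → Y_N … whose kernel we denote by Π^tp_{Z_N}». A predicate on `D`; to be inhabited at genuine models, never asserted.
[cite: MochizukiEtTh2009, §1 p.14] -/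
def GtpZNFromSplitting (D : ThetaSetting p) (N : ℕ+) : Prop :=
  ∀ s : ↥(D.GKN N) → D.GtpTheta, D.IsThetaSplittingAt N s →
    ∀ g : D.PiTemp, g ∈ D.GtpZN N ↔
      g ∈ D.GtpYN N ∧ ∃ h : D.aug g ∈ D.GJN N,
        D.toTheta g * (s ⟨D.aug g, D.GJN_le_GKN N h⟩)⁻¹ ∈ D.thetaPowersY N

end ThetaSetting

end Literature.AnabelianGeometry.EtaleTheta

end
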